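import Summits.BirchSwinnertonDyer.Rank1Residual.X10.BeyondCarrierResidualOfTwins
import Summits.BirchSwinnertonDyer.BirchSwinnertonDyer.Theses.PrintX10b
import HarnessLib

/-!
# Crux `BeyondCarrierDepthX10b` (stmt-BirchSwinnertonDyer-23055, `route-BirchSwinnertonDyer-PrintX10b`
# rev 19, rank 301) needs only the EULER-SYSTEM HALF of the anticyclotomic main conjecture:
# the crux BY NAME from ONE one-sided link U₃ = (IMC≤ ∘ BDP)ᵍ at `p = 3` and THREE named facts

HONEST FRAMING (cell `run/shared/lean/pub/bsd-print-x9/`, D-0154 row 10 width seat `bsd-line-x10b-p1-w2`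
on the registered line 8c72ce4e of crux 23055): THEOREMS ONLY, nothing booked, nothing closed.
«beyond-print theorem»: NO — conditional kernel glue; the ONE open input is the one-sided link U₃ below
(beyond print at `3 ∣ h_K`; on the `3 ∤ h_K` frames it is print modulo the cell's cite-only composite,
see `upperLinkX10b_of_twins`), plus the cite-only facts `h331` / `hChaL` / `hKo`. BSD is not proved by
any of this.

WHY (the structural point, kernel-checked below). The registered skeleton v3 (8c72ce4e) and the doors of
record (p587786 `beyondCarrierDepthX10b_of_namedFacts_of_twins`, p581943, p581299, T-A p586853) derive the
crux from the TWO-SIDED package: Howard's containment A₃ (item 23729) fed into the two-sided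
IMC∘Waldspurger link B₃ (item 23730), which yields the Heegner-index IDENTITY
`2·ord_3 ∏ c_ℓ + ord_3 #Ш(E/K) = 2·ord_3 [E(K):ℤy_K]` (`X11b.IndexIdentityAt`), plus FIVE cite-only facts
(`h46`, `hYZ` for the `3 ∤ h_K` frames; `h331`, `hChaL`, `hKo`). But the crux's argument (T-A §2: a
non-divisible derived point `P_n` at a beyond-carrier depth `s ≤ t` is a level-`s` certificate, so Cha's
LOWER half gives `2(M₀ − s + 1) ≤ ord_3 #Ш`, contradiction) consumes only the INEQUALITY
`ord_3 #Ш(E/K) + 2·ord_3 ∏ c_ℓ(E) ≤ 2·ord_3 [E(K):ℤy_K]` — the UPPER bound on `Ш · Tam²`, i.e. the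
co-STEP-L shape `SchneiderFree.Upper.IndexUpperBoundLeAt W 3 K y_K 0`. Through the control theorem
(CTL)ᵍ (JSW 2017 Thm. 3.3.1, `h331`, class-number-free, `p ≥ 3`), in which the anomaly term cancels,
that inequality is EXACTLY the one-sided link

  U₃ := on every frame of B₃ (X10b pair, `K` imaginary quadratic with odd `d_K ≠ −3`, Heegner for
        `N_E` and `3`, (irr_K), Manin-good datum, `P = y_K` of infinite order, `rank_ℤ E(K) = 1`,
        `Ш[3^∞]` finite, ANY class number), for the tree's `X_ac = XAc (E_K) 3 κ (inducedPlace ι) ∅ γ`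
        with characteristic valuation `n = ord_3 f_ac(0)`:  `n ≤ 2·(ord_3 log_ω P + ord_3(1 − a_3 + 3) − 1)`,

i.e. `ord_3 f_ac(0) ≤ ord_3 L_3^{BDP}(𝟙)` — the divisibility `(L_p^{BDP}(𝟙)) ⊆ (f_ac(0))`, the
EULER-SYSTEM («Selmer is small», Kolyvagin / Howard / Castella–Hsieh) direction of the BDP main conjecture
at the trivial character; the mirror image of the tree's `X11b.IMCLowerWaldspurgerOnTreeGoodAt` (the
Eisenstein-congruence direction `ord_3 L_3(𝟙) ≤ ord_3 f_ac(0)` consumed by STEP L). CONSEQUENCES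
(numbers, not adjectives): the crux AND its parent J₃ (21340) follow from U₃ and THREE named facts (`h331`,
`hChaL`, `hKo`) with NO class-number split — ONE one-sided open input where the doors of record take TWO
two-sided items (23729, 23730; p587786 with five facts, the lead's v4 door with three); the
«Selmer is large» half of B₃ (Wan / BCS 2025 Thm. 1.2.4 / Yan–Zhu at `p = 3`), the tree-family
containment currency of A₃ (`heegnerCharIdeal`, hence the module comparison `cmp_familyLeStabilized` and
the torsion-depth split of line `torsion-depth-x10b`) and the facts `h46` / `hYZ` are all OFF the load
path of 23055 once U₃ is supplied directly. `upperLinkX10b_of_twins` certifies that U₃ is WEAKER than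
the registered pair: item 23729 ∧ item 23730 ⇒ U₃.

WHAT.
* `sha_add_tamagawaSplit_le_of_onTreeGoodUpperLink` — bookkeeping at any good `p`: U-link ∧ (CTL)ᵍ at one
  datum ⇒ `ord_p #Ш(E/K)[p^∞] + ord_p ∏_{w∣N⁺} c_w(E/K) ≤ 2·ord_p [E(K):ℤP]` (the anomaly term cancels;
  mirror of `X11b.two_mul_index_le_of_onTreeGoodLowerLinks`).
* `shaTamagawa_le_index_of_heegnerPoint_of_upperLink_of_thm331` — at a Manin-unit Heegner datum of an X10b
  pair over a Heegner field with `3` split, `d_K` odd `< −4`, `y_K` of infinite order, ANY class number: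
  `ord_3 #Ш(E/K) + 2·ord_3 ∏ c_ℓ(E) ≤ 2·ord_3 [E(K):ℤP]` from U₃, `h331`, `hKo` (T-A §1 with the two-sided
  link replaced by U₃ and the identity by the inequality).
* `heegnerDivisibilityX10b_of_namedFacts_of_upperLink (h331) (hChaL) (hKo) (hU) : Theses.PrintX10b.HeegnerDivisibilityX10b`
  — the PARENT J₃ (item 21340: ALL depths, ALL class numbers) BY NAME, bound `B = 4`, no case split (the
  lead's `heegnerDivisibilityX10b_of_twins_of_namedFacts` with the identity replaced by the inequality);
  `beyondCarrierDepthX10b_of_namedFacts_of_upperLink` — the child crux 23055 BY NAME (a weakening).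
* `upperLinkX10b_of_twins : HowardContainmentAnyClassNumberX10b → TwoSidedLinkAnyClassNumberX10b → U₃` (items ⇒ U₃).

References: [JetchevSkinnerWan2017] Thm. 3.3.1, §7.3.1 (eq:tamK), §7.4.1; [Castella2018] Thm. 2.3, Thm. 3.2,
§5; [CastellaHsieh2018] Thm. 1 (the Euler-system divisibility of the BDP main conjecture, p ∤ h_K);
[Howard2004HeegnerKolyvagin] Thm. B; [CastellaGrossiLeeSkinner2022] Thm. 4.1.3, §5; [Cha2005] Rmk. 25;
[Kolyvagin1990] Thm. A; [MatarNekovar2019] Prop. 5.26 (2); skeleton 8c72ce4e; route file `Theses/PrintX10b.lean` rev 19.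
-/

-- the REGISTERED stub namespace `Summit.BirchSwinnertonDyer.BirchSwinnertonDyer.Cruxes.…` repeats the summit name
set_option linter.dupNamespace false
set_option autoImplicit false

noncomputable section

open scoped Classical MatrixGroups ModularForm

open CongruenceSubgroup WeierstrassCurve NumberField IsDedekindDomain
  Literature.NumberTheory.EllipticCurves Literature.NumberTheory.EllipticCurves.ModularForms
  Literature.NumberTheory.EllipticCurves.JetchevSkinnerWan2017
  Literature.NumberTheory.EllipticCurves.YanZhu2026
  Summit.BirchSwinnertonDyer.BirchSwinnertonDyer.Theorems.Rank1ResidualX1Defs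
  Summit.BirchSwinnertonDyer.Rank1Residual
  Summit.BirchSwinnertonDyer.Rank1Residual.X11b.Three.Koly
  Summit.BirchSwinnertonDyer.Rank1Residual.X11b.KolyvaginBottom
  Summit.BirchSwinnertonDyer.BirchSwinnertonDyer.Rank1Residual
  Summit.BirchSwinnertonDyer.BirchSwinnertonDyer.Theses.PrintX10b

open Literature.NumberTheory.EllipticCurves.Rank1Residual (ClassX10 Surj)

namespace Summit.BirchSwinnertonDyer.BirchSwinnertonDyer.Cruxes.BeyondCarrierDepthX10b.UpperHalf

/-- **Bookkeeping at any good prime: the anomaly term cancels in the EULER-SYSTEM direction.** At one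
anticyclotomic datum `(κ, 𝔭, γ, ι)`, the one-sided link `ord_p f_ac(0) ≤ 2·(ord_p log_ω P +
ord_p(1 − a_p + p) − 1)` (the divisibility `(L_p^{BDP}(𝟙)) ⊆ (f_ac(0))` read through Castella 2018
Thm. 3.2) and the control theorem (CTL)ᵍ (`X11b.ControlOnTreeGoodAt`: `ord_p f_ac(0) = ord_p #Ш[p^∞] +
2((ord_p log_ω P + ord_p(1 − a_p + p) − 1) − ord_p[E(K):ℤP]) + ord_p ∏_{w∣N⁺} c_w`) give
`ord_p #Ш(E/K)[p^∞] + ord_p ∏_{w∣N⁺} c_w(E/K) ≤ 2·ord_p[E(K):ℤP]`; the two generators' valuations agree by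
`XAc.HasCharValuationAt.unique`, the rest is `omega`. Mirror of `X11b.two_mul_index_le_of_onTreeGoodLowerLinks`.
[cite: JetchevSkinnerWan2017, Thm. 3.3.1 and §7.4.1 (arXiv:1512.06894 pp. 11, 30)] [cite: Castella2018, Thm. 2.3, Thm. 3.2] -/
theorem sha_add_tamagawaSplit_le_of_onTreeGoodUpperLink {W : WeierstrassCurve ℚ} [W.IsElliptic]
    [W.IsGloballyMinimal] {K : Type} [Field K] [NumberField K] {p : ℕ} [Fact p.Prime]
    {κ : ZpExtension K p} {𝔭 : IsDedekindDomain.HeightOneSpectrum (𝓞 K)} {γ : Field.absoluteGaloisGroup K}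
    [Fact (κ.IsTopGenerator γ)] {ι : K →+* ℚ_[p]} {P : (W.baseChange K).toAffine.Point}
    (hU : ∃ n : ℕ, X11b.AcSelmer.XAc.HasCharValuationAt (W.baseChange K) p κ 𝔭 ∅ γ n ∧
      (n : ℤ) ≤ 2 * (X11b.padicLogOrd W p ι P + (padicValInt p (1 - W.frobeniusTrace p + p) : ℤ) - 1))
    (hCTL : X11b.ControlOnTreeGoodAt p κ 𝔭 γ ι P) :
    (padicValNat p (Nat.card (AddCommGroup.primaryComponent (W.baseChange K).sha p)) : ℤ) +
        padicValNat p (X11b.tamagawaProductSplit W K) ≤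
      2 * (padicValNat p (AddSubgroup.zmultiples P).index : ℤ) := by
  obtain ⟨n, hn, hle⟩ := hU
  obtain ⟨n', hn', heq⟩ := hCTL
  obtain rfl : n = n' := hn.unique hn'
  omega

/-- **The UPPER bound `ord_3 #Ш(E/K) + 2·ord_3 ∏ c_ℓ(E) ≤ 2·ord_3 [E(K):ℤP]` at a Manin-unit Heegner datum of a
NON-CM X10b pair (`p = 3`, `E[3]` irreducible, `ρ̄_{E,3}` not onto) over a Heegner field with `3` split,
`d_K` odd `< −4`, ANY class number, whose Heegner point `P` has INFINITE ORDER — from the ONE-SIDED link U₃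
(hypothesis `hU`, the Euler-system direction of the BDP main conjecture at `𝟙` on these frames), JSW Thm.
3.3.1 (`h331`) and Kolyvagin (`hKo`).** T-A's `indexIdentityAt_of_heegnerPoint_of_twins_of_thm331`
(p586853 §1) with the pair (A₃, B₃) replaced by U₃ and the identity by the inequality: rank one and
finiteness over `K` by Kolyvagin, (irr_K) by Matar–Nekovář Prop. 5.26 (2) (tree theorem), the control
link by `X11b.controlOnTreeGoodAt_of_thm331_of_inducedPlace`, the Tamagawa transport
`ord_3 ∏_{w∣N⁺} c_w = ord_3 ∏_w c_w(E/K) = 2·ord_3 ∏_ℓ c_ℓ` by `X11b.padicValNat_tamagawa_of_heegner_anyPrime`.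
[cite: JetchevSkinnerWan2017, Thm. 3.3.1, §7.3.1 (eq:tamK), §7.4.1] [cite: Kolyvagin1990, Thm. A]
[cite: MatarNekovar2019, Prop. 5.26 (2)] [cite: Castella2018, Thm. 2.3, Thm. 3.2] -/
theorem shaTamagawa_le_index_of_heegnerPoint_of_upperLink_of_thm331
    (hU : ∀ (W : WeierstrassCurve ℚ) [W.IsElliptic] [W.IsGloballyMinimal] (p : ℕ) [Fact p.Prime]
    [NeZero (W.conductorNorm ℤ)] (K : Type) [Field K] [NumberField K],
    Literature.NumberTheory.EllipticCurves.Rank1Residual.ClassX10 W p →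
    ¬ Literature.NumberTheory.EllipticCurves.Rank1Residual.Surj W 3 → ¬ W.HasCM →
    Literature.NumberTheory.EllipticCurves.IsImaginaryQuadratic K → Odd (NumberField.discr K) →
    NumberField.discr K ≠ -3 →
    Literature.NumberTheory.EllipticCurves.SatisfiesHeegnerHypothesis (W.conductorNorm ℤ) K →
    Literature.NumberTheory.EllipticCurves.SatisfiesHeegnerHypothesis p K →
    (W.baseChange K).HasIrreducibleModPGaloisRep p →
    ∀ (ι : K →+* ℚ_[p]) (κ : Literature.NumberTheory.EllipticCurves.ZpExtension K p), κ.IsAnticyclotomic →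
    ∀ (γ : Field.absoluteGaloisGroup K) [Fact (κ.IsTopGenerator γ)]
      (Dt : Literature.NumberTheory.EllipticCurves.ModularForms.ModularParametrizationData W
        (W.conductorNorm ℤ)), ¬ (p : ℤ) ∣ Dt.c →
    ∀ (H : Literature.NumberTheory.EllipticCurves.HeegnerDatum (W.conductorNorm ℤ) (NumberField.discr K))
      (ιC : K →+* ℂ) (P : (W.baseChange K).toAffine.Point),
      WeierstrassCurve.Affine.Point.map ιC.toRatAlgHom P =
        Literature.NumberTheory.EllipticCurves.ModularForms.heegnerPointComplex Dt H →
      (W.baseChange K).mordellWeilRank = 1 →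
      Finite (AddCommGroup.primaryComponent (W.baseChange K).sha p) → ¬ IsOfFinAddOrder P →
    ∃ n : ℕ, Summit.BirchSwinnertonDyer.Rank1Residual.X11b.AcSelmer.XAc.HasCharValuationAt
        (W.baseChange K) p κ (Summit.BirchSwinnertonDyer.Rank1Residual.X11b.inducedPlace ι) ∅ γ n ∧
      (n : ℤ) ≤ 2 * (Summit.BirchSwinnertonDyer.Rank1Residual.X11b.padicLogOrd W p ι P +
        (padicValInt p (1 - W.frobeniusTrace p + p) : ℤ) - 1))
    (h331 : thm331_anticyclotomicControl)
    (W : WeierstrassCurve ℚ) [W.IsElliptic] [W.IsGloballyMinimal] [NeZero (W.conductorNorm ℤ)]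
    (p : ℕ) [Fact p.Prime] (hX : ClassX10 W p) (hns : ¬ Surj W 3) (hcm : ¬ W.HasCM)
    (K : Type) [Field K] [NumberField K] (hKo : kolyvagin (W.conductorNorm ℤ) W K)
    (hK : IsImaginaryQuadratic K) (hodd : Odd (NumberField.discr K)) (hlt : NumberField.discr K < -4)
    (hHN : SatisfiesHeegnerHypothesis (W.conductorNorm ℤ) K) (hHp : SatisfiesHeegnerHypothesis p K)
    (Dt : ModularParametrizationData W (W.conductorNorm ℤ))
    (H : HeegnerDatum (W.conductorNorm ℤ) (NumberField.discr K)) (ιC : K →+* ℂ)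
    (P : (W.baseChange K).toAffine.Point)
    (hP : WeierstrassCurve.Affine.Point.map ιC.toRatAlgHom P = heegnerPointComplex Dt H)
    (hPinf : ¬ IsOfFinAddOrder P) (hc : ¬ (p : ℤ) ∣ Dt.c) :
    padicValNat p (W.baseChange K).shaOrder + 2 * padicValNat p W.tamagawaProduct ≤
      2 * padicValNat p (AddSubgroup.zmultiples P).index := by
  obtain ⟨hp3, hord, hirr, -⟩ := id hX
  subst hp3
  have hpP : (3 : ℕ).Prime := Fact.out
  have hp2 : (3 : ℕ) ≠ 2 := by norm_num
  have h3 : NumberField.discr K ≠ -3 := by omega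
  -- rank one and finiteness over `K` (Kolyvagin, from the non-torsion Heegner point)
  obtain ⟨hrk, hshaK⟩ := hKo hK hHN ⟨Dt, H, ιC, hP⟩ hPinf
  haveI : Finite (W.baseChange K).sha := hshaK
  have hfinp : Finite (AddCommGroup.primaryComponent (W.baseChange K).sha 3) :=
    Finite.of_injective _ Subtype.val_injective
  -- (irr_K) at this field (Matar–Nekovář Prop. 5.26 (2), a tree theorem)
  have hirrK : (W.baseChange K).HasIrreducibleModPGaloisRep 3 :=
    MatarNekovar2019.prop526_hasIrreducibleModPGaloisRep_baseChange_holds W K hK.1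
      (Literature.SatisfiesHeegnerHypothesis.coprime_discr hK.1 hHN) 3 hp2 hirr
  -- the anticyclotomic datum and the embedding at a prime above `3`
  obtain ⟨κ, γ, 𝔭, hκ, hγ, h𝔭⟩ := X11b.exists_anticyclotomic_generator_prime (p := 3) hK
  haveI : Fact (κ.IsTopGenerator γ) := ⟨hγ⟩
  have hsplit : X11b.SplitsIn K 3 := hHp 3 Fact.out (dvd_refl 3)
  obtain ⟨he, hf⟩ := X11b.degreeOne_of_splitsIn hK.1 hsplit h𝔭
  set ι : K →+* ℚ_[3] := X11b.embAt K 3 𝔭 h𝔭 he hf with hι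
  -- the control link (JSW Thm. 3.3.1) at the induced place
  have hCTL : X11b.ControlOnTreeGoodAt 3 κ (X11b.inducedPlace ι) γ ι P :=
    X11b.controlOnTreeGoodAt_of_thm331_of_inducedPlace h331 le_rfl hord.1 hK hHp rfl hHN hirrK ι
      κ hκ γ hrk hfinp P hPinf
  -- the ONE-SIDED link U₃ at this datum
  have hup := hU W 3 K hX hns hcm hK hodd h3 hHN hHp hirrK ι κ hκ γ Dt hc H ιC P hP hrk hfinp hPinf
  have h := sha_add_tamagawaSplit_le_of_onTreeGoodUpperLink hup hCTL
  obtain ⟨h1, h2⟩ := X11b.padicValNat_tamagawa_of_heegner_anyPrime (W := W) 3 hK rfl hHN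
  rw [h1, h2, padicValNat_card_addPrimaryComponent (A := (W.baseChange K).sha) 3] at h
  rw [WeierstrassCurve.shaOrder]
  omega

/-- **J₃ = `HeegnerDivisibilityX10b` (stmt-BirchSwinnertonDyer-21340, the PARENT of crux 23055) BY NAME from
the ONE-SIDED link U₃ and THREE named facts** (`h331` JSW 2017 Thm. 3.3.1, `hChaL` Cha 2005 Rmk. 25 lower
half, `hKo` Kolyvagin 1990 Thm. A; Shimura reciprocity at conductor `1` and (irr_K) are tree theorems): on
every rev-3b X10b Heegner frame (`p = 3`, `E[3]` irreducible, `ρ̄_{E,3}` not onto, non-CM, `r_an = 1`;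
`d_K ≡ 1 (mod 8)`, `N_E` and `3` split, Manin-good, `y_K` of infinite order), ANY class number, for EVERY
depth `s ≤ ord_3 ∏ c_q(E)`, every derived Heegner point `P_n` on Kolyvagin primes of index `≥ s` is
`3^s`-divisible in `E(K[n])` (bound `B = 4`, no case split). The lead's
`heegnerDivisibilityX10b_of_twins_of_namedFacts` (line «twins», skeleton v4) VERBATIM up to its last three
lines, where the identity `2t + ord_3 #Ш = 2M₀` (from A₃ ∧ B₃) is replaced by the inequality
`ord_3 #Ш + 2t ≤ 2M₀` of `shaTamagawa_le_index_of_heegnerPoint_of_upperLink_of_thm331` (from U₃): a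
non-divisible `P_n` at depth `s ≤ t` is a level-`(s−1)` certificate ⇒ `2(M₀ − s + 1) ≤ ord_3 #Ш(E/K)` (Cha's
lower half) ⇒ `t < s`, absurd.
[cite: Cha2005, Thm. 21 and Rmk. 25] [cite: JetchevSkinnerWan2017, Thm. 3.3.1] [cite: Kolyvagin1990, Thm. A]
[cite: McCallumLMS1991, §5 (Lemma 5.1)] [cite: Darmon2004, Thm. 3.7] [cite: MatarNekovar2019, Thm. 0.7, §0.9, §0.11] -/
theorem heegnerDivisibilityX10b_of_namedFacts_of_upperLink
    (h331 : thm331_anticyclotomicControl)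
    (hChaL : Cha2005.rmk25_pow_dvd_card_sha_primary_of_certificate)
    (hKo : ∀ (N : ℕ) [NeZero N] (W : WeierstrassCurve ℚ) (K : Type) [Field K] [NumberField K],
      kolyvagin N W K)
    (hU : ∀ (W : WeierstrassCurve ℚ) [W.IsElliptic] [W.IsGloballyMinimal] (p : ℕ) [Fact p.Prime]
    [NeZero (W.conductorNorm ℤ)] (K : Type) [Field K] [NumberField K],
    Literature.NumberTheory.EllipticCurves.Rank1Residual.ClassX10 W p →
    ¬ Literature.NumberTheory.EllipticCurves.Rank1Residual.Surj W 3 → ¬ W.HasCM →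
    Literature.NumberTheory.EllipticCurves.IsImaginaryQuadratic K → Odd (NumberField.discr K) →
    NumberField.discr K ≠ -3 →
    Literature.NumberTheory.EllipticCurves.SatisfiesHeegnerHypothesis (W.conductorNorm ℤ) K →
    Literature.NumberTheory.EllipticCurves.SatisfiesHeegnerHypothesis p K →
    (W.baseChange K).HasIrreducibleModPGaloisRep p →
    ∀ (ι : K →+* ℚ_[p]) (κ : Literature.NumberTheory.EllipticCurves.ZpExtension K p), κ.IsAnticyclotomic →
    ∀ (γ : Field.absoluteGaloisGroup K) [Fact (κ.IsTopGenerator γ)]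
      (Dt : Literature.NumberTheory.EllipticCurves.ModularForms.ModularParametrizationData W
        (W.conductorNorm ℤ)), ¬ (p : ℤ) ∣ Dt.c →
    ∀ (H : Literature.NumberTheory.EllipticCurves.HeegnerDatum (W.conductorNorm ℤ) (NumberField.discr K))
      (ιC : K →+* ℂ) (P : (W.baseChange K).toAffine.Point),
      WeierstrassCurve.Affine.Point.map ιC.toRatAlgHom P =
        Literature.NumberTheory.EllipticCurves.ModularForms.heegnerPointComplex Dt H →
      (W.baseChange K).mordellWeilRank = 1 →
      Finite (AddCommGroup.primaryComponent (W.baseChange K).sha p) → ¬ IsOfFinAddOrder P →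
    ∃ n : ℕ, Summit.BirchSwinnertonDyer.Rank1Residual.X11b.AcSelmer.XAc.HasCharValuationAt
        (W.baseChange K) p κ (Summit.BirchSwinnertonDyer.Rank1Residual.X11b.inducedPlace ι) ∅ γ n ∧
      (n : ℤ) ≤ 2 * (Summit.BirchSwinnertonDyer.Rank1Residual.X11b.padicLogOrd W p ι P +
        (padicValInt p (1 - W.frobeniusTrace p + p) : ℤ) - 1)) :
    HeegnerDivisibilityX10b := by
  intro W _ _ _ p _ hX hns hcm _
  obtain ⟨hp3, hordW, hirr, -⟩ := id hX
  subst hp3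
  refine ⟨4, ?_⟩
  intro K _ _ Dt β ι hK hBK hd8 hHN hHp hβ hc d₁ hd₁ s hs n d hn hℓ
  -- Shimura reciprocity at conductor `1`: a tree THEOREM (Darmon Thm. 3.7)
  have hrec : ∀ (N : ℕ) [NeZero N] (W : WeierstrassCurve ℚ) (K : Type) [Field K] [NumberField K],
      heegnerPointOfConductor_one_galoisConj N W K :=
    fun N _ W K _ _ ↦ heegnerPointOfConductor_one_galoisConj_holds N W K
  have hodd : Odd (NumberField.discr K) := Int.odd_iff.mpr (by omega)
  have hpP : (3 : ℕ).Prime := Fact.out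
  have hp2 : (3 : ℕ) ≠ 2 := by norm_num
  have hneg : NumberField.discr K < 0 := IsImaginaryQuadratic.discr_neg hK
  have hlt : NumberField.discr K < -4 := by omega
  have h3 : NumberField.discr K ≠ -3 := by omega
  have h4 : NumberField.discr K ≠ -4 := by omega
  have hpd : ¬ ((3 : ℕ) : ℤ) ∣ NumberField.discr K :=
    Literature.SatisfiesHeegnerHypothesis.not_dvd_discr hK.1 hHp hpP (dvd_refl 3)
  have hpN : ¬ 3 ∣ W.conductorNorm ℤ := fun h ↦
    (W.dvd_conductorNorm_iff_not_hasGoodReductionAtPrime 3).mp h hordW.1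
  have hpN2 : ¬ 3 ^ 2 ∣ W.conductorNorm ℤ := fun h ↦ hpN (dvd_trans (dvd_pow_self 3 two_ne_zero) h)
  -- depth `0` is trivial
  rcases Nat.eq_zero_or_pos s with rfl | hs1
  · exact ⟨d.derivedPoint, by rw [pow_zero, Nat.cast_one, one_zsmul]⟩
  -- the oriented Heegner datum of the frame and THE Heegner point `y_K ∈ E(K)`
  obtain ⟨H, hHβ⟩ := exists_heegnerDatum (W.conductorNorm ℤ) hneg hβ
  obtain ⟨P, hP⟩ := heegnerPointComplex_mem_range_map_holds (W.conductorNorm ℤ) W K hK hHN Dt H ι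
  have hPd : d₁.toGeomPoints d₁.derivedPoint = toGeomPoints (W.baseChange K) P :=
    toGeomPoints_derivedPoint_one_eq (hrec _ W K) hK hHN hP d₁ hHβ
  have hPinf : ¬ IsOfFinAddOrder P := fun hfin ↦
    hd₁ ((isOfFinAddOrder_derivedPoint_one_iff (hrec _ W K) hK hHN hP d₁ hHβ).mpr hfin)
  -- the UPPER bound over `K` at this frame, ANY class number (from U₃, h331, hKo)
  have hup := shaTamagawa_le_index_of_heegnerPoint_of_upperLink_of_thm331 hU h331 W 3 hX hns hcm K
    (hKo _ W K) hK hodd hlt hHN hHp Dt H ι P hP hPinf hc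
  -- rank one and finiteness over `K` (Kolyvagin), no `p`-torsion (irreducibility)
  obtain ⟨hrank, hshaK⟩ := hKo (W.conductorNorm ℤ) W K hK hHN ⟨Dt, H, ι, hP⟩ hPinf
  haveI : Finite (W.baseChange K).sha := hshaK
  haveI hfinp : Finite (AddCommGroup.primaryComponent (W.baseChange K).sha 3) :=
    Finite.of_injective _ Subtype.val_injective
  have hbot := torsionBy_eq_bot_of_isImaginaryQuadratic_of_hasIrreducibleModPGaloisRep W K hK hpP hirr
  have hiv : ∀ x : (W.baseChange K).toAffine.Point, 3 • x = 0 → x = 0 := fun x hx ↦ by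
    have hmem : x ∈ AddSubgroup.torsionBy (W.baseChange K).toAffine.Point (((3 : ℕ) : ℕ) : ℤ) := by
      rw [mem_torsionBy_iff, natCast_zsmul]
      exact hx
    rw [hbot] at hmem
    exact hmem
  -- the exponent `p^{M₀} ∥ y_K` in `E(K)` and `ord_p [E(K):ℤy_K] = M₀` (McCallum Lemma 5.1)
  haveI : Module.Finite ℤ (W.baseChange K).toAffine.Point := (W.baseChange K).module_finite_point_holds
  obtain ⟨M₀, x₀, hx₀, hmax⟩ := exists_pow_smul_eq_and_forall_ne hPinf (p := 3) hpP.two_le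
  have hdiv : ∃ Q : (W.baseChange K).toAffine.Point, ((3 ^ M₀ : ℕ) : ℤ) • Q = P :=
    ⟨x₀, by rw [natCast_zsmul]; exact hx₀⟩
  have hndiv : ¬ ∃ Q : (W.baseChange K).toAffine.Point, ((3 ^ (M₀ + 1) : ℕ) : ℤ) • Q = P := by
    rintro ⟨Q, hQ⟩
    exact hmax Q (by rw [← natCast_zsmul]; exact hQ)
  haveI : Finite (AddCommGroup.torsion (W.baseChange K).toAffine.Point) :=
    WeierstrassCurve.finite_torsion_point (W := W.baseChange K)
  obtain ⟨c, Q, hcQ, hcker⟩ := X11b.RankOne.exists_coord_of_mordellWeilRank_eq_one (W.baseChange K) hrank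
  have hidx : padicValNat 3 (AddSubgroup.zmultiples P).index = M₀ :=
    padicValNat_index_zmultiples_eq_of_divisibility c Q hcQ hcker hiv P hdiv hndiv
  -- suppose `P_n ∉ 3^s E(K_n)`: a level-`s` certificate; Cha's LOWER half bounds `#Ш` from below
  by_contra hQ
  have hcert := hChaL W hcm K hK h3 h4 hHN 3 hp2 hpd hpN2 hirr Dt β ι d₁ P hPd hPinf M₀
    hdiv hndiv n (s - 1) d hn
    (fun ℓ hℓ' ↦ ⟨(hℓ ℓ hℓ').1, by have := (hℓ ℓ hℓ').2; omega⟩)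
    (by rw [Nat.sub_add_cancel hs1]; exact hQ)
  have hle : 2 * (M₀ - (s - 1)) ≤
      padicValNat 3 (Nat.card (AddCommGroup.primaryComponent (W.baseChange K).sha 3)) :=
    (padicValNat_dvd_iff_le Nat.card_pos.ne').mp hcert
  rw [padicValNat_card_addPrimaryComponent (A := (W.baseChange K).sha) 3] at hle
  -- the inequality: `ord_p #Ш(E/K) + 2t ≤ 2M₀`
  rw [WeierstrassCurve.shaOrder, hidx] at hup
  omega

/-- **Crux `BeyondCarrierDepthX10b` (item 23055) BY NAME from the ONE-SIDED link U₃ and THREE named facts**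
(`h331`, `hChaL`, `hKo`) — the child is a weakening of the parent J₃ (the beyond-carrier clause is
dropped; same term as the lead's `HowardFrames.beyondCarrierDepthX10b_of_heegnerDivisibilityX10b`). Compared with the
doors of record (p587786: items 23729 ∧ 23730 + five facts; the lead's
`beyondCarrierDepthX10b_of_twins_of_threeFacts`: items 23729 ∧ 23730 + three facts) the TWO two-sided items
are replaced by ONE one-sided link. [cite: Cha2005, Thm. 21 and Rmk. 25] [cite: JetchevSkinnerWan2017, Thm. 3.3.1]
[cite: Kolyvagin1990, Thm. A] -/
theorem beyondCarrierDepthX10b_of_namedFacts_of_upperLink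
    (h331 : thm331_anticyclotomicControl)
    (hChaL : Cha2005.rmk25_pow_dvd_card_sha_primary_of_certificate)
    (hKo : ∀ (N : ℕ) [NeZero N] (W : WeierstrassCurve ℚ) (K : Type) [Field K] [NumberField K],
      kolyvagin N W K)
    (hU : ∀ (W : WeierstrassCurve ℚ) [W.IsElliptic] [W.IsGloballyMinimal] (p : ℕ) [Fact p.Prime]
    [NeZero (W.conductorNorm ℤ)] (K : Type) [Field K] [NumberField K],
    Literature.NumberTheory.EllipticCurves.Rank1Residual.ClassX10 W p →
    ¬ Literature.NumberTheory.EllipticCurves.Rank1Residual.Surj W 3 → ¬ W.HasCM →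
    Literature.NumberTheory.EllipticCurves.IsImaginaryQuadratic K → Odd (NumberField.discr K) →
    NumberField.discr K ≠ -3 →
    Literature.NumberTheory.EllipticCurves.SatisfiesHeegnerHypothesis (W.conductorNorm ℤ) K →
    Literature.NumberTheory.EllipticCurves.SatisfiesHeegnerHypothesis p K →
    (W.baseChange K).HasIrreducibleModPGaloisRep p →
    ∀ (ι : K →+* ℚ_[p]) (κ : Literature.NumberTheory.EllipticCurves.ZpExtension K p), κ.IsAnticyclotomic →
    ∀ (γ : Field.absoluteGaloisGroup K) [Fact (κ.IsTopGenerator γ)]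
      (Dt : Literature.NumberTheory.EllipticCurves.ModularForms.ModularParametrizationData W
        (W.conductorNorm ℤ)), ¬ (p : ℤ) ∣ Dt.c →
    ∀ (H : Literature.NumberTheory.EllipticCurves.HeegnerDatum (W.conductorNorm ℤ) (NumberField.discr K))
      (ιC : K →+* ℂ) (P : (W.baseChange K).toAffine.Point),
      WeierstrassCurve.Affine.Point.map ιC.toRatAlgHom P =
        Literature.NumberTheory.EllipticCurves.ModularForms.heegnerPointComplex Dt H →
      (W.baseChange K).mordellWeilRank = 1 →
      Finite (AddCommGroup.primaryComponent (W.baseChange K).sha p) → ¬ IsOfFinAddOrder P →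
    ∃ n : ℕ, Summit.BirchSwinnertonDyer.Rank1Residual.X11b.AcSelmer.XAc.HasCharValuationAt
        (W.baseChange K) p κ (Summit.BirchSwinnertonDyer.Rank1Residual.X11b.inducedPlace ι) ∅ γ n ∧
      (n : ℤ) ≤ 2 * (Summit.BirchSwinnertonDyer.Rank1Residual.X11b.padicLogOrd W p ι P +
        (padicValInt p (1 - W.frobeniusTrace p + p) : ℤ) - 1)) :
    BeyondCarrierDepthX10b := by
  intro W _ _ _ p _ hX hns hcm hr
  obtain ⟨B, hJB⟩ := heegnerDivisibilityX10b_of_namedFacts_of_upperLink h331 hChaL hKo hU W p hX hns hcm hr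
  exact ⟨B, fun K _ _ Dt β ι hK hBK hd8 hHN hHp hβ hc d₁ hd₁ s _ hs n d hn hℓ ↦
    hJB K Dt β ι hK hBK hd8 hHN hHp hβ hc d₁ hd₁ s hs n d hn hℓ⟩

/-- **The one-sided link U₃ is WEAKER than the registered pair of items**: Howard's containment at any class
number (item 23729, `HowardContainmentAnyClassNumberX10b`) and the two-sided link granted the containment
(item 23730, `TwoSidedLinkAnyClassNumberX10b`) give the EQUALITY `X11b.IMCWaldspurgerOnTreeGoodAt`, whose
`≤` half is U₃ (`d_K ≠ −4` because `d_K` is odd). So the doors of record factor through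
`beyondCarrierDepthX10b_of_namedFacts_of_upperLink`, and nothing of the registered line is lost.
[cite: Castella2018, §5 (eq:IMC+BDP)] [cite: Howard2004HeegnerKolyvagin, Thm. B] -/
theorem upperLinkX10b_of_twins (hA : HowardContainmentAnyClassNumberX10b) (hB : TwoSidedLinkAnyClassNumberX10b) :
    ∀ (W : WeierstrassCurve ℚ) [W.IsElliptic] [W.IsGloballyMinimal] (p : ℕ) [Fact p.Prime]
    [NeZero (W.conductorNorm ℤ)] (K : Type) [Field K] [NumberField K],
    Literature.NumberTheory.EllipticCurves.Rank1Residual.ClassX10 W p →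
    ¬ Literature.NumberTheory.EllipticCurves.Rank1Residual.Surj W 3 → ¬ W.HasCM →
    Literature.NumberTheory.EllipticCurves.IsImaginaryQuadratic K → Odd (NumberField.discr K) →
    NumberField.discr K ≠ -3 →
    Literature.NumberTheory.EllipticCurves.SatisfiesHeegnerHypothesis (W.conductorNorm ℤ) K →
    Literature.NumberTheory.EllipticCurves.SatisfiesHeegnerHypothesis p K →
    (W.baseChange K).HasIrreducibleModPGaloisRep p →
    ∀ (ι : K →+* ℚ_[p]) (κ : Literature.NumberTheory.EllipticCurves.ZpExtension K p), κ.IsAnticyclotomic →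
    ∀ (γ : Field.absoluteGaloisGroup K) [Fact (κ.IsTopGenerator γ)]
      (Dt : Literature.NumberTheory.EllipticCurves.ModularForms.ModularParametrizationData W
        (W.conductorNorm ℤ)), ¬ (p : ℤ) ∣ Dt.c →
    ∀ (H : Literature.NumberTheory.EllipticCurves.HeegnerDatum (W.conductorNorm ℤ) (NumberField.discr K))
      (ιC : K →+* ℂ) (P : (W.baseChange K).toAffine.Point),
      WeierstrassCurve.Affine.Point.map ιC.toRatAlgHom P =
        Literature.NumberTheory.EllipticCurves.ModularForms.heegnerPointComplex Dt H →
      (W.baseChange K).mordellWeilRank = 1 →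
      Finite (AddCommGroup.primaryComponent (W.baseChange K).sha p) → ¬ IsOfFinAddOrder P →
    ∃ n : ℕ, Summit.BirchSwinnertonDyer.Rank1Residual.X11b.AcSelmer.XAc.HasCharValuationAt
        (W.baseChange K) p κ (Summit.BirchSwinnertonDyer.Rank1Residual.X11b.inducedPlace ι) ∅ γ n ∧
      (n : ℤ) ≤ 2 * (Summit.BirchSwinnertonDyer.Rank1Residual.X11b.padicLogOrd W p ι P +
        (padicValInt p (1 - W.frobeniusTrace p + p) : ℤ) - 1) := by
  intro W _ _ p _ _ K _ _ hX hns hcm hK hodd h3 hHN hHp hirrK ι κ hκ γ _ Dt hc H ιC P hP hrk hfinp hPinf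
  have h4 : NumberField.discr K ≠ -4 := by
    rintro h
    rw [h] at hodd
    exact absurd hodd (by decide)
  have hHow := hA W p K hX hns hcm hK h3 h4 hHN hHp κ hκ γ Fact.out Dt H ιC
  obtain ⟨n, hn, heq⟩ := hB W p K hX hns hcm hK hodd h3 hHN hHp hirrK ι κ hκ γ Dt hc H ιC P hP hrk hfinp
    hPinf hHow
  exact ⟨n, hn, le_of_eq heq⟩

end Summit.BirchSwinnertonDyer.BirchSwinnertonDyer.Cruxes.BeyondCarrierDepthX10b.UpperHalf

end
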